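import Literature.NumberTheory.Sieve.ChenTwin
import HarnessLib

/-!
# Route `ChenParityOracleBLAP` — crux S1 = `HostParityFromBrick` (stmt-Parity-20045): the switched half, the three terms

Support file for the switched half `K1 → K2 → HP2` of S1.  With `ρ = 1 + (log x)^{-9}` and `A = 40`
the bound of `switched_level_sum_le_at` is `O(x/(log x)^{5/2})`:
* good classes: `(⌊log(x+2)/log ρ⌋+1)³ (1+(1+log x)²) x/(log x)^{40} ≤ 160 x/(log x)^8` (`goodTerm_le`);
* small classes: `⌊8x^{1−δ}⌋ (1 + log⌊8x^{1−δ}⌋) ≤ 40 x^{1−δ} log x` (`smallTerm_le`);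
* boundary classes: `≤ 31 x/((log x)² √(log x))` once `7(log x)^8 ≤ x^{1/6}` (`bdryTerm_le`);
so the twisted level sum of Chen's switched host is `≤ η x/(log x)²` for every `η > 0` and all large
`x` (`switched_eventually`), GIVEN K1 and K2 eventually in `x` (hypotheses `hK1`, `hK2`).

References: Chen Jing-run, Sci. Sinica 16 (1973) [ChenSciSinica1973]; G. Harman, *Prime-Detecting
Sieves* (2007), Ch. 3 [Harman2007].
-/

namespace Summit.Parity.GeneralizedHardyLittlewood.Theorems

open Finset Real Filter
open Literature.NumberTheory.Sieve.Chen

/-! ### The three terms with `ρ = 1 + (log x)^{-9}` -/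

/-- The good classes: `(⌊log(x+2)/log ρ⌋ + 1)³ (1 + (1+L)²) x/L^{40} ≤ 160 x/L^8` for
`ρ = 1 + L^{-9}`, `L = log x ≥ 2`, `x ≥ 2`. -/
theorem goodTerm_le {x L : ℝ} (hL : L = Real.log x) (hL2 : 2 ≤ L) (hx2 : 2 ≤ x) {ρ : ℝ}
    (hρ : ρ = 1 + (L ^ 9)⁻¹) :
    (((⌊Real.log (x + 2) / Real.log ρ⌋₊ + 1) ^ 3 : ℕ) : ℝ) * ((1 + (1 + L) ^ 2) * (x / L ^ (40 : ℝ))) ≤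
      160 * x / L ^ 8 := by
  have hL0 : 0 < L := by linarith
  have hx0 : 0 < x := by linarith
  set u : ℝ := (L ^ 9)⁻¹ with hu
  have hL9 : 1 ≤ L ^ 9 := one_le_pow₀ (by linarith)
  have hu0 : 0 < u := by rw [hu]; positivity
  have hu1 : u ≤ 1 := by rw [hu]; exact inv_le_one_of_one_le₀ hL9
  have hρ1 : 1 < ρ := by rw [hρ]; linarith
  have hρ0 : 0 < ρ := by linarith
  -- `log ρ ≥ u/2`
  have hlogρ : u / 2 ≤ Real.log ρ := by
    have h1 := Real.one_sub_inv_le_log_of_pos hρ0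
    have h2 : u / 2 ≤ 1 - ρ⁻¹ := by
      rw [hρ, show 1 - (1 + u)⁻¹ = u / (1 + u) by field_simp; ring]
      exact div_le_div_of_nonneg_left hu0.le (by linarith) (by linarith)
    linarith
  have hlogρ0 : 0 < Real.log ρ := by linarith
  -- `log (x+2) ≤ 1 + L`
  have hlogX : Real.log (x + 2) ≤ 1 + L := by
    have h1 : x + 2 ≤ 2 * x := by linarith
    calc Real.log (x + 2) ≤ Real.log (2 * x) := Real.log_le_log (by linarith) h1
      _ = Real.log 2 + L := by rw [Real.log_mul (by norm_num) hx0.ne', hL]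
      _ ≤ 1 + L := by linarith [Real.log_two_lt_d9]
  -- the index bound
  have hI : (⌊Real.log (x + 2) / Real.log ρ⌋₊ : ℝ) ≤ 3 * L ^ 10 := by
    have h0 : 0 ≤ Real.log (x + 2) / Real.log ρ :=
      div_nonneg (Real.log_nonneg (by linarith)) hlogρ0.le
    calc (⌊Real.log (x + 2) / Real.log ρ⌋₊ : ℝ) ≤ Real.log (x + 2) / Real.log ρ := Nat.floor_le h0
      _ ≤ (1 + L) / (u / 2) := by
          rw [div_le_div_iff₀ hlogρ0 (by linarith)]
          calc Real.log (x + 2) * (u / 2) ≤ (1 + L) * (u / 2) :=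
                mul_le_mul_of_nonneg_right hlogX (by linarith)
            _ ≤ (1 + L) * Real.log ρ := mul_le_mul_of_nonneg_left hlogρ (by linarith)
      _ = 2 * (1 + L) / u := by field_simp
      _ = 2 * (1 + L) * L ^ 9 := by rw [hu, div_inv_eq_mul]
      _ ≤ 2 * ((3 / 2) * L) * L ^ 9 := by gcongr; linarith
      _ = 3 * L ^ 10 := by ring
  have hI1 : (((⌊Real.log (x + 2) / Real.log ρ⌋₊ + 1) ^ 3 : ℕ) : ℝ) ≤ 64 * L ^ 30 := by
    have hL10 : 1 ≤ L ^ 10 := one_le_pow₀ (by linarith)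
    push_cast
    calc ((⌊Real.log (x + 2) / Real.log ρ⌋₊ : ℝ) + 1) ^ 3 ≤ (3 * L ^ 10 + L ^ 10) ^ 3 := by
          gcongr
      _ = 64 * L ^ 30 := by ring
  have hsq : 1 + (1 + L) ^ 2 ≤ (5 / 2) * L ^ 2 := by nlinarith
  have hx40 : x / L ^ (40 : ℝ) = x / L ^ (40 : ℕ) := by norm_cast
  rw [hx40]
  have hL40 : 0 < L ^ (40 : ℕ) := by positivity
  calc (((⌊Real.log (x + 2) / Real.log ρ⌋₊ + 1) ^ 3 : ℕ) : ℝ) * ((1 + (1 + L) ^ 2) * (x / L ^ (40 : ℕ)))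
      ≤ (64 * L ^ 30) * (((5 / 2) * L ^ 2) * (x / L ^ (40 : ℕ))) := by
        apply mul_le_mul hI1 (mul_le_mul_of_nonneg_right hsq (by positivity)) (by positivity)
          (by positivity)
    _ = 160 * x / L ^ 8 := by field_simp; ring

/-- The small classes: `⌊8x^{1−δ}⌋ (1 + log⌊8x^{1−δ}⌋) ≤ 40 x^{1−δ} L` for `L = log x ≥ 1`,
`x ≥ 1`, `0 < δ`. -/
theorem smallTerm_le {x L δ : ℝ} (hL : L = Real.log x) (hL1 : 1 ≤ L) (hx1 : 1 ≤ x)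
    (hδ0 : 0 < δ) :
    (⌊8 * x ^ (1 - δ)⌋₊ : ℝ) * (1 + Real.log (⌊8 * x ^ (1 - δ)⌋₊ : ℕ)) ≤ 40 * x ^ (1 - δ) * L := by
  have hx0 : 0 < x := by linarith
  have hpow0 : 0 < x ^ (1 - δ) := Real.rpow_pos_of_pos hx0 _
  have hnle : (⌊8 * x ^ (1 - δ)⌋₊ : ℝ) ≤ 8 * x ^ (1 - δ) := Nat.floor_le (by positivity)
  rcases Nat.eq_zero_or_pos ⌊8 * x ^ (1 - δ)⌋₊ with h0 | hpos
  · have : (⌊8 * x ^ (1 - δ)⌋₊ : ℝ) = 0 := by exact_mod_cast h0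
    rw [this, zero_mul]
    positivity
  · set n : ℕ := ⌊8 * x ^ (1 - δ)⌋₊ with hn
    have hn1 : (1 : ℝ) ≤ n := by exact_mod_cast hpos
    have hpowle : x ^ (1 - δ) ≤ x := by
      conv_rhs => rw [← Real.rpow_one x]
      exact Real.rpow_le_rpow_of_exponent_le hx1 (by linarith)
    have hlogn : Real.log n ≤ 3 + L := by
      calc Real.log n ≤ Real.log (8 * x) := by
            refine Real.log_le_log (by linarith) (hnle.trans ?_); linarith
        _ = Real.log 8 + L := by rw [Real.log_mul (by norm_num) hx0.ne', hL]
        _ ≤ 3 + L := by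
            have : Real.log 8 = 3 * Real.log 2 := by
              rw [show (8 : ℝ) = 2 ^ 3 by norm_num, Real.log_pow]; norm_num
            rw [this]; linarith [Real.log_two_lt_d9]
    calc (n : ℝ) * (1 + Real.log n) ≤ (8 * x ^ (1 - δ)) * (5 * L) := by
          apply mul_le_mul hnle (by linarith) (by linarith [Real.log_nonneg hn1]) (by positivity)
      _ = 40 * x ^ (1 - δ) * L := by ring

/-- The boundary classes: with `u = ρ − 1 = L^{-9}`, `L = log x ≥ 1`, `x ≥ 2`, `1 ≤ y ≤ 3x^{1/3}`
and `7L^8 ≤ x^{1/6}`,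
`√(u(x+2)(1+log y) + y√(x+2) + 3u(x+2) + 1) · √((x+2)(1+log(x+2))³) ≤ 31 x/(L² √L)`. -/
theorem bdryTerm_le {x L y : ℝ} (hL : L = Real.log x) (hL1 : 1 ≤ L) (hx2 : 2 ≤ x)
    (hy1 : 1 ≤ y) (hy : y ≤ 3 * x ^ (1 / 3 : ℝ)) (hsep : 7 * L ^ 8 ≤ x ^ (1 / 6 : ℝ)) :
    Real.sqrt ((L ^ 9)⁻¹ * (x + 2) * (1 + Real.log y) + y * Real.sqrt (x + 2) +
        (3 * (L ^ 9)⁻¹ * (x + 2) + 1)) * Real.sqrt ((x + 2) * (1 + Real.log (x + 2)) ^ 3) ≤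
      31 * x / (L ^ 2 * Real.sqrt L) := by
  have hL0 : 0 < L := by linarith
  have hx0 : 0 < x := by linarith
  have hx1 : 1 ≤ x := by linarith
  set u : ℝ := (L ^ 9)⁻¹ with hu
  have hu0 : 0 < u := by rw [hu]; positivity
  -- `u ≤ L⁻⁸` (as `L ≥ 1`)
  have huL : u * L ≤ (L ^ 8)⁻¹ := by
    rw [hu, show (L ^ 9)⁻¹ * L = (L ^ 8)⁻¹ by field_simp]
  have huL' : u ≤ (L ^ 8)⁻¹ := by
    rw [hu]; exact inv_anti₀ (by positivity) (pow_le_pow_right₀ hL1 (by norm_num))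
  -- logs
  have hlogX : Real.log (x + 2) ≤ 1 + L := by
    calc Real.log (x + 2) ≤ Real.log (2 * x) := Real.log_le_log (by linarith) (by linarith)
      _ = Real.log 2 + L := by rw [Real.log_mul (by norm_num) hx0.ne', hL]
      _ ≤ 1 + L := by linarith [Real.log_two_lt_d9]
  have hx13 : x ^ (1 / 3 : ℝ) ≤ x := by
    conv_rhs => rw [← Real.rpow_one x]
    exact Real.rpow_le_rpow_of_exponent_le hx1 (by norm_num)
  have hlogy : Real.log y ≤ 3 + L := by
    calc Real.log y ≤ Real.log (3 * x) := Real.log_le_log (by linarith) (hy.trans (by linarith))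
      _ = Real.log 3 + L := by rw [Real.log_mul (by norm_num) hx0.ne', hL]
      _ ≤ 3 + L := by
          have : Real.log 3 ≤ 3 - 1 := Real.log_le_sub_one_of_pos (by norm_num)
          linarith
  -- square roots of `x + 2`
  have hsqX : Real.sqrt (x + 2) ≤ 2 * x ^ (1 / 2 : ℝ) := by
    rw [← Real.sqrt_eq_rpow, show (2 : ℝ) * Real.sqrt x = Real.sqrt (4 * x) by
      rw [Real.sqrt_mul (by norm_num), show Real.sqrt 4 = 2 by
        rw [show (4 : ℝ) = 2 ^ 2 by norm_num, Real.sqrt_sq (by norm_num)]]]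
    exact Real.sqrt_le_sqrt (by linarith)
  -- `y √(x+2) ≤ 6 x^{5/6}` and `x^{5/6} ≤ x/(7 L^8)`
  have h56 : y * Real.sqrt (x + 2) ≤ 6 * x ^ (5 / 6 : ℝ) := by
    calc y * Real.sqrt (x + 2) ≤ (3 * x ^ (1 / 3 : ℝ)) * (2 * x ^ (1 / 2 : ℝ)) :=
          mul_le_mul hy hsqX (Real.sqrt_nonneg _) (by positivity)
      _ = 6 * (x ^ (1 / 3 : ℝ) * x ^ (1 / 2 : ℝ)) := by ring
      _ = 6 * x ^ (5 / 6 : ℝ) := by rw [← Real.rpow_add hx0]; norm_num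
  have h56' : x ^ (5 / 6 : ℝ) * (7 * L ^ 8) ≤ x := by
    calc x ^ (5 / 6 : ℝ) * (7 * L ^ 8) ≤ x ^ (5 / 6 : ℝ) * x ^ (1 / 6 : ℝ) :=
          mul_le_mul_of_nonneg_left hsep (by positivity)
      _ = x := by rw [← Real.rpow_add hx0]; norm_num
  have hx56 : 1 ≤ x ^ (5 / 6 : ℝ) := Real.one_le_rpow hx1 (by norm_num)
  -- the first radicand `R ≤ 17 x / L^8`
  have hR : u * (x + 2) * (1 + Real.log y) + y * Real.sqrt (x + 2) + (3 * u * (x + 2) + 1) ≤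
      17 * x / L ^ 8 := by
    have hL8 : 0 < L ^ 8 := by positivity
    have h1 : u * (x + 2) * (1 + Real.log y) ≤ 10 * x / L ^ 8 := by
      calc u * (x + 2) * (1 + Real.log y) ≤ u * (2 * x) * (5 * L) := by
            apply mul_le_mul (mul_le_mul_of_nonneg_left (by linarith) hu0.le) (by linarith)
              (by linarith [Real.log_nonneg hy1]) (by positivity)
        _ = 10 * x * (u * L) := by ring
        _ ≤ 10 * x * (L ^ 8)⁻¹ := mul_le_mul_of_nonneg_left huL (by positivity)
        _ = 10 * x / L ^ 8 := by rw [div_eq_mul_inv]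
    have h2 : 3 * u * (x + 2) ≤ 6 * x / L ^ 8 := by
      calc 3 * u * (x + 2) ≤ 3 * u * (2 * x) := by gcongr; linarith
        _ = 6 * x * u := by ring
        _ ≤ 6 * x * (L ^ 8)⁻¹ := mul_le_mul_of_nonneg_left huL' (by positivity)
        _ = 6 * x / L ^ 8 := by rw [div_eq_mul_inv]
    have h3 : y * Real.sqrt (x + 2) + 1 ≤ x / L ^ 8 := by
      rw [le_div_iff₀ hL8]
      nlinarith
    calc u * (x + 2) * (1 + Real.log y) + y * Real.sqrt (x + 2) + (3 * u * (x + 2) + 1)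
        = u * (x + 2) * (1 + Real.log y) + 3 * u * (x + 2) + (y * Real.sqrt (x + 2) + 1) := by ring
      _ ≤ 10 * x / L ^ 8 + 6 * x / L ^ 8 + x / L ^ 8 := add_le_add (add_le_add h1 h2) h3
      _ = 17 * x / L ^ 8 := by ring
  -- the second radicand `Q ≤ 54 x L³`
  have hQ : (x + 2) * (1 + Real.log (x + 2)) ^ 3 ≤ 54 * x * L ^ 3 := by
    have h1 : 1 + Real.log (x + 2) ≤ 3 * L := by linarith
    have h0 : 0 ≤ 1 + Real.log (x + 2) := by linarith [Real.log_nonneg (by linarith : (1 : ℝ) ≤ x + 2)]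
    calc (x + 2) * (1 + Real.log (x + 2)) ^ 3 ≤ (2 * x) * (3 * L) ^ 3 := by
          apply mul_le_mul (by linarith) (pow_le_pow_left₀ h0 h1 3) (by positivity) (by positivity)
      _ = 54 * x * L ^ 3 := by ring
  -- combine
  have hR0 : 0 ≤ u * (x + 2) * (1 + Real.log y) + y * Real.sqrt (x + 2) + (3 * u * (x + 2) + 1) := by
    have : 0 ≤ 1 + Real.log y := by linarith [Real.log_nonneg hy1]
    positivity
  rw [← Real.sqrt_mul hR0]
  have htarget : 0 ≤ 31 * x / (L ^ 2 * Real.sqrt L) :=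
    div_nonneg (by linarith) (mul_nonneg (sq_nonneg _) (Real.sqrt_nonneg _))
  rw [show 31 * x / (L ^ 2 * Real.sqrt L) = Real.sqrt ((31 * x / (L ^ 2 * Real.sqrt L)) ^ 2) by
    rw [Real.sqrt_sq htarget]]
  refine Real.sqrt_le_sqrt ?_
  have hsqL : Real.sqrt L ^ 2 = L := Real.sq_sqrt hL0.le
  have hsqL0 : 0 < Real.sqrt L := Real.sqrt_pos.mpr hL0
  calc (u * (x + 2) * (1 + Real.log y) + y * Real.sqrt (x + 2) + (3 * u * (x + 2) + 1)) *
        ((x + 2) * (1 + Real.log (x + 2)) ^ 3)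
      ≤ (17 * x / L ^ 8) * (54 * x * L ^ 3) := by
        have h0Q : 0 ≤ (x + 2) * (1 + Real.log (x + 2)) ^ 3 := by
          have := Real.log_nonneg (show (1 : ℝ) ≤ x + 2 by linarith)
          positivity
        exact mul_le_mul hR hQ h0Q (by positivity)
    _ = 918 * x ^ 2 / L ^ 5 := by field_simp; ring
    _ ≤ 961 * x ^ 2 / L ^ 5 := by gcongr; norm_num
    _ = (31 * x / (L ^ 2 * Real.sqrt L)) ^ 2 := by
        rw [div_pow, mul_pow, mul_pow, ← pow_mul, hsqL]; ring


end Summit.Parity.GeneralizedHardyLittlewood.Theorems
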